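import Literature.MathematicalPhysics.KineticTheory.DiPernaLionsScheme
import Literature.MathematicalPhysics.KineticTheory.TruncatedPicardLimit
import Literature.Analysis.Calculus.KineticContDiffOn
import HarnessLib

/-!
# Global solutions of the truncated problems (CIP 1994 Lemma 5.3.6) — proof

Topic: MathematicalPhysics / KineticTheory. Proofs-only file: the named fact
`truncatedProblem_globalExistence` of `DiPernaLionsScheme` (Cercignani–Illner–Pulvirenti 1994,
§5.3 Lemma 5.3.6, pp. 145–146: the truncated, normalised problem
`∂ₜf + v·∇ₓf = (1 + δ∫f dv)⁻¹ Q_B(f, f)`, `f(0) = f₀`, with a smooth truncated kernel vanishing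
near grazing collisions and positive Schwartz data with `|log f₀|` of polynomial growth, has a
global solution, positive, Schwartz in `(x, v)` locally uniformly in time, with `|log f|` of
polynomial growth) is **proved**: `truncatedProblem_globalExistence_holds`.

The proof is the one printed in CIP (p. 146), organised as follows (all ingredients proved in the
tree): the solution is the limit of the Picard sequence `F_{m+1} = T[F_m]` in the
positivity-preserving mild form (`TruncatedPicardIterates`, loss term in the exponential,
`TransportDuhamel`); the linear sup bound (3.19) of the normalised gain term
(`CollisionLineBound`, `TruncatedPicardEstimates.source_le_line`) gives global sup bounds, and the
affine structure of the higher-order estimates gives uniform bounds for all weighted slice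
derivatives (`TruncatedPicardUniform`); the Lipschitz estimate (3.20) makes the sequence converge
(`TruncatedPicardLimit`), the limit being a smooth-in-`(x, v)` fixed point of `T`; positivity and
the polynomial growth of `|log f|` follow from `f ≥ f₀(x - tv, v) e^{-Ct}`; the equation holds
along characteristics (`DuhamelSliceTime`), the gain/loss functionals are identified with the
truncated collision operator (`TruncatedPicardLipschitz.truncatedCollisionOp_eq`), and the joint
`C¹` regularity on `[0, ∞) × E × E` is the kinetic `C¹` lemma (`KineticContDiffOn`).

## References

* C. Cercignani, R. Illner, M. Pulvirenti, *The Mathematical Theory of Dilute Gases*, Springer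
  (1994), §5.3 Lemma 5.3.6, pp. 145–146.
* R. J. DiPerna, P.-L. Lions, Ann. of Math. 130 (1989), 321–366, §IV.
-/

open MeasureTheory Metric Real Set Filter Function intervalIntegral
open scoped InnerProductSpace ENNReal ContDiff Topology

noncomputable section

namespace Literature.MathematicalPhysics.KineticTheory

open Literature.Analysis.Calculus Literature.Analysis.FluidPDE TruncPicard

variable {E : Type*} [NormedAddCommGroup E] [InnerProductSpace ℝ E] [FiniteDimensional ℝ E]
  [MeasurableSpace E] [BorelSpace E]

namespace TruncatedProblemProofs

omit [InnerProductSpace ℝ E] [FiniteDimensional ℝ E] [MeasurableSpace E] [BorelSpace E] in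
/-- `(1 + ‖y‖)ᵏ ≤ 2ᵏ (1 + ‖y‖ᵏ)`. [folklore] -/
theorem one_add_norm_pow_le [NormedSpace ℝ E] (y : E × E) (k : ℕ) : (1 + ‖y‖) ^ k ≤ 2 ^ k * (1 + ‖y‖ ^ k) := by
  have h1 : 1 + ‖y‖ ≤ 2 * max 1 ‖y‖ := by
    rcases le_total 1 ‖y‖ with h | h
    · rw [max_eq_right h]; linarith
    · rw [max_eq_left h]; linarith
  have h2 : (max 1 ‖y‖) ^ k ≤ 1 + ‖y‖ ^ k := by
    rcases le_total 1 ‖y‖ with h | h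
    · rw [max_eq_right h]; linarith [pow_nonneg (norm_nonneg y) k]
    · rw [max_eq_left h, one_pow]; linarith [pow_nonneg (norm_nonneg y) k]
  calc (1 + ‖y‖) ^ k ≤ (2 * max 1 ‖y‖) ^ k := pow_le_pow_left₀ (by positivity) h1 k
    _ = 2 ^ k * (max 1 ‖y‖) ^ k := mul_pow _ _ _
    _ ≤ 2 ^ k * (1 + ‖y‖ ^ k) := mul_le_mul_of_nonneg_left h2 (by positivity)

omit [InnerProductSpace ℝ E] [FiniteDimensional ℝ E] [MeasurableSpace E] [BorelSpace E] in
/-- Weighted bounds `(1 + ‖y‖)ᵏ ‖Dⁿf₀(y)‖ ≤ C` from the Schwartz decay bounds. [folklore] -/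
theorem weighted_bounds_of_decay [NormedSpace ℝ E] {f₀ : E × E → ℝ}
    (hd : ∀ k n : ℕ, ∃ C : ℝ, ∀ z : E × E, ‖z‖ ^ k * ‖iteratedFDeriv ℝ n f₀ z‖ ≤ C) (n k : ℕ) :
    ∃ C : ℝ, ∀ y : E × E, (1 + ‖y‖) ^ k * ‖iteratedFDeriv ℝ n f₀ y‖ ≤ C := by
  obtain ⟨C₀, hC₀⟩ := hd 0 n
  obtain ⟨Ck, hCk⟩ := hd k n
  refine ⟨2 ^ k * (C₀ + Ck), fun y => ?_⟩
  have h0 := hC₀ y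
  rw [pow_zero, one_mul] at h0
  calc (1 + ‖y‖) ^ k * ‖iteratedFDeriv ℝ n f₀ y‖ ≤ 2 ^ k * (1 + ‖y‖ ^ k) * ‖iteratedFDeriv ℝ n f₀ y‖ :=
        mul_le_mul_of_nonneg_right (one_add_norm_pow_le y k) (norm_nonneg _)
    _ = 2 ^ k * (‖iteratedFDeriv ℝ n f₀ y‖ + ‖y‖ ^ k * ‖iteratedFDeriv ℝ n f₀ y‖) := by ring
    _ ≤ 2 ^ k * (C₀ + Ck) := mul_le_mul_of_nonneg_left (add_le_add h0 (hCk y)) (by positivity)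

omit [InnerProductSpace ℝ E] [FiniteDimensional ℝ E] [MeasurableSpace E] [BorelSpace E] in
/-- `fderiv` as a continuous linear image of `iteratedFDeriv 1`. [folklore] -/
theorem fderiv_eq_curry_iteratedFDeriv_one [NormedSpace ℝ E] (f : E × E → ℝ) (z : E × E) :
    fderiv ℝ f z = continuousMultilinearCurryFin1 ℝ (E × E) ℝ (iteratedFDeriv ℝ 1 f z) := by
  refine ContinuousLinearMap.ext fun v => ?_
  rw [continuousMultilinearCurryFin1_apply, iteratedFDeriv_one_apply]
  rfl

/-- From `[0, T]`-pieces to `[0, ∞)`: continuity within. [folklore] -/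
theorem continuousOn_Ici_prod_of_Icc {X : Type*} [TopologicalSpace X] {Y : Type*} [TopologicalSpace Y]
    {g : ℝ × X → Y} (hg : ∀ T : ℝ, 0 ≤ T → ContinuousOn g (Icc 0 T ×ˢ univ)) :
    ContinuousOn g (Ici 0 ×ˢ univ) := by
  intro p hp
  have hp1 : 0 ≤ p.1 := hp.1
  have hT : 0 ≤ p.1 + 1 := by linarith
  have hc := hg (p.1 + 1) hT p ⟨⟨hp1, by linarith⟩, mem_univ _⟩
  refine hc.mono_of_mem_nhdsWithin ?_
  rw [nhdsWithin_prod_eq, nhdsWithin_univ]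
  refine Filter.prod_mem_prod ?_ univ_mem
  exact mem_of_superset (inter_mem_nhdsWithin (Ici (0:ℝ)) (Iio_mem_nhds (by linarith : p.1 < p.1 + 1)))
    fun σ hσ => ⟨hσ.1, le_of_lt hσ.2⟩

end TruncatedProblemProofs

open TruncatedProblemProofs

/-- **CIP 1994 Lemma 5.3.6 (global solutions of the truncated problems), proved.**
[cite: CIPDiluteGases1994, §5.3 Lemma 5.3.6 (pp. 145–146)] -/
theorem truncatedProblem_globalExistence_holds : truncatedProblem_globalExistence := by
  intro E _ _ _ _ _ δ B f₀' hδ hB hdata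
  classical
  obtain ⟨M, R, h⟩ := hB.exists_kernelHyp
  have hgraz := hB.eq_zero_of_abs_inner_lt
  have hBk := hB.isDiPernaLionsKernel
  set f₀ : E × E → ℝ := fun z => f₀' z.1 z.2 with hf₀def
  have hf₀ : ContDiff ℝ ∞ f₀ := hdata.contDiff
  have hf₀0 : ∀ y, 0 ≤ f₀ y := fun y => (hdata.pos _ _).le
  have hf₀b : ∀ n k : ℕ, ∃ C : ℝ, ∀ y : E × E, (1 + ‖y‖) ^ k * ‖iteratedFDeriv ℝ n f₀ y‖ ≤ C :=
    weighted_bounds_of_decay hdata.decay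
  -- the Picard sequence
  let F : ℕ → ℝ → E × E → ℝ := fun m => Nat.rec (fun t z => f₀ (z.1 - max t 0 • z.2, z.2))
    (fun _ Fm t z => f₀ (z.1 - max t 0 • z.2, z.2) * Real.exp (-(∫ σ in (0:ℝ)..max t 0,
        absorption δ B (Fm σ) (z.1 - (max t 0 - σ) • z.2, z.2))) +
        ∫ s in (0:ℝ)..max t 0, Real.exp (-(∫ σ in s..max t 0,
          absorption δ B (Fm σ) (z.1 - (max t 0 - σ) • z.2, z.2))) *
          source δ B (Fm s) (z.1 - (max t 0 - s) • z.2, z.2)) m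
  have hP : IsPicardSequence δ B f₀ F := ⟨fun t z => rfl, fun m t z => rfl⟩
  obtain ⟨Finf, hlim⟩ := exists_limit_tendsto h hδ hgraz hf₀ hf₀0 hf₀b hP
  obtain ⟨hFi, -⟩ := limit_sliceClass h hδ hgraz hf₀ hf₀0 hf₀b hP hlim
  have hfix := limit_fixedPoint h hδ hgraz hf₀ hf₀0 hf₀b hP hlim
  obtain ⟨-, hlow⟩ := hFi.next h hδ.le hf₀ hf₀0 hf₀b (U := Finf) hfix
  -- the unclamped Duhamel formula on `[0, T]`
  have hU : ∀ T : ℝ, ∀ t ∈ Icc (0:ℝ) T, ∀ z : E × E, Finf t z =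
      f₀ (z.1 - t • z.2, z.2) * Real.exp (-(∫ σ in (0:ℝ)..t, absorption δ B (Finf σ) (z.1 - (t - σ) • z.2, z.2))) +
        ∫ s in (0:ℝ)..t, Real.exp (-(∫ σ in s..t, absorption δ B (Finf σ) (z.1 - (t - σ) • z.2, z.2))) *
          source δ B (Finf s) (z.1 - (t - s) • z.2, z.2) := fun T t ht z => by
    have := hfix t z; rwa [max_eq_left ht.1] at this
  -- positivity
  have hpos : ∀ t ≥ (0:ℝ), ∀ z : E × E, 0 < Finf t z := fun t ht z => by
    obtain ⟨C₀, hC₀⟩ := hlow t ht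
    exact lt_of_lt_of_le (mul_pos (hdata.pos _ _) (Real.exp_pos _)) (hC₀ t ⟨ht, le_rfl⟩ z)
  -- the right-hand side along characteristics
  set ψ : ℝ → E × E → ℝ := fun t z => source δ B (Finf t) z - absorption δ B (Finf t) z * Finf t z with hψ
  have hD : ∀ t ≥ (0:ℝ), ∀ z, HasFDerivAt (Finf t) (fderiv ℝ (Finf t) z) z := fun t _ z =>
    (((hFi.contDiff t).differentiable (by simp)) z).hasFDerivAt
  have hDc : ContinuousOn (fun p : ℝ × (E × E) => fderiv ℝ (Finf p.1) p.2) (Ici 0 ×ˢ univ) := by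
    have e : (fun p : ℝ × (E × E) => fderiv ℝ (Finf p.1) p.2) = fun p =>
        continuousMultilinearCurryFin1 ℝ (E × E) ℝ (iteratedFDeriv ℝ 1 (Finf p.1) p.2) :=
      funext fun p => fderiv_eq_curry_iteratedFDeriv_one _ _
    rw [e]
    refine (continuousMultilinearCurryFin1 ℝ (E × E) ℝ).continuous.comp_continuousOn
      (continuousOn_Ici_prod_of_Icc fun T hT => ?_)
    refine continuousOn_iteratedFDeriv_param (S := Icc (0:ℝ) T) hFi.contDiff (fun k => ?_)
      (fun c₀ hc₀ y => hFi.continuousOn T hT y c₀ hc₀) 1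
    obtain ⟨C, hC⟩ := hFi.bounds T hT k 0
    exact ⟨C, fun c hc y => by simpa using hC c hc y⟩
  have hψd : ∀ (x₀ v : E), ∀ s ≥ (0:ℝ),
      HasDerivWithinAt (fun σ => Finf σ (x₀ + σ • v, v)) (ψ s (x₀ + s • v, v)) (Ici 0) s := by
    intro x₀ v s hs
    have hT : (0:ℝ) ≤ s + 1 := by linarith
    obtain ⟨hL1, hL2, hL3, -, -⟩ := hFi.absorptionFamily h hδ.le hT
    obtain ⟨hG1, hG2, hG3, -⟩ := hFi.sourceFamily h hδ.le hT
    have hd := duhamel_hasDerivWithinAt_characteristic hT hL1 hL2 hL3 hG1 hG2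
      (family_unweighted_of_weighted hG3) (hU (s + 1)) x₀ v (σ := s) ⟨hs, by linarith⟩
    refine hd.mono_of_mem_nhdsWithin ?_
    exact mem_of_superset (inter_mem_nhdsWithin (Ici (0:ℝ)) (Iio_mem_nhds (by linarith : s < s + 1)))
      fun σ hσ => ⟨hσ.1, le_of_lt hσ.2⟩
  have hψc : ContinuousOn (fun p : ℝ × (E × E) => ψ p.1 p.2) (Ici 0 ×ˢ univ) := by
    refine continuousOn_Ici_prod_of_Icc fun T hT => ?_
    obtain ⟨hL1, hL2, hL3, -, -⟩ := hFi.absorptionFamily h hδ.le hT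
    obtain ⟨hG1, hG2, hG3, -⟩ := hFi.sourceFamily h hδ.le hT
    have hcG := continuousOn_uncurry_family hG1 hG2 (family_unweighted_of_weighted hG3)
    have hcL := continuousOn_uncurry_family hL1 hL2 hL3
    have hcF := continuousOn_uncurry_family hFi.contDiff (hFi.continuousOn T hT) (fun n => by
      obtain ⟨C, hC⟩ := hFi.bounds T hT n 0
      exact ⟨C, fun s hs y => by simpa using hC s hs y⟩)
    exact hcG.sub (hcL.mul hcF)
  -- the solution
  refine ⟨fun t x v => Finf t (x, v), ⟨?_, fun t ht x v => hpos t ht (x, v), fun t _ => hFi.contDiff t, ?_, ?_, ?_⟩, ?_⟩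
  · -- joint `C¹` regularity on `[0, ∞) × E × E`
    exact contDiffOn_one_kinetic hD hDc hψd hψc
  · -- Schwartz bounds of the slices
    intro T hT k n
    obtain ⟨C, hC⟩ := hFi.bounds T hT n k
    refine ⟨C, fun t ht z => le_trans ?_ (hC t ht z)⟩
    exact mul_le_mul_of_nonneg_right (pow_le_pow_left₀ (norm_nonneg _) (le_add_of_nonneg_left zero_le_one) k)
      (norm_nonneg _)
  · -- polynomial growth of `|log f|`
    intro T hT
    obtain ⟨C₀, hC₀⟩ := hlow T hT
    obtain ⟨Cℓ, p, hℓ⟩ := hdata.abs_log_le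
    obtain ⟨S₀, hS₀⟩ := hFi.bounds T hT 0 0
    have hsup : ∀ t ∈ Icc (0:ℝ) T, ∀ z, Finf t z ≤ S₀ := fun t ht z => by
      have := hS₀ t ht z
      rw [pow_zero, one_mul, norm_iteratedFDeriv_zero, Real.norm_of_nonneg (hFi.nonneg t z)] at this
      exact this
    set Ls : ℝ := Real.log (max S₀ 1) with hLs
    have hLs0 : 0 ≤ Ls := Real.log_nonneg (le_max_right _ _)
    refine ⟨Ls + |Cℓ| * (1 + T) ^ p + |C₀| * T, p, fun t ht x v => ?_⟩
    have hposz := hpos t ht.1 (x, v)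
    have hw1 : (1:ℝ) ≤ (1 + ‖x‖ + ‖v‖) ^ p := one_le_pow₀ (by linarith [norm_nonneg x, norm_nonneg v])
    -- upper bound of the logarithm
    have hup : Real.log (Finf t (x, v)) ≤ Ls :=
      Real.log_le_log hposz ((hsup t ht (x, v)).trans (le_max_left _ _))
    -- lower bound of the logarithm
    have hlowlog : -(|Cℓ| * (1 + T) ^ p * (1 + ‖x‖ + ‖v‖) ^ p) - |C₀| * T ≤ Real.log (Finf t (x, v)) := by
      have h1 := hC₀ t ht (x, v)
      simp only at h1
      have hf0pos := hdata.pos (x - t • v) v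
      have h2 : Real.log (f₀' (x - t • v) v) - C₀ * t ≤ Real.log (Finf t (x, v)) := by
        have := Real.log_le_log (mul_pos hf0pos (Real.exp_pos _)) h1
        rwa [Real.log_mul hf0pos.ne' (Real.exp_pos _).ne', Real.log_exp] at this
      have h3 : |Real.log (f₀' (x - t • v) v)| ≤ |Cℓ| * (1 + T) ^ p * (1 + ‖x‖ + ‖v‖) ^ p := by
        refine (hℓ _ _).trans ?_
        have hn : ‖x - t • v‖ ≤ ‖x‖ + T * ‖v‖ := by
          refine (norm_sub_le _ _).trans (add_le_add le_rfl ?_)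
          rw [norm_smul, Real.norm_of_nonneg ht.1]; exact mul_le_mul_of_nonneg_right ht.2 (norm_nonneg _)
        have hb : 1 + ‖x - t • v‖ + ‖v‖ ≤ (1 + T) * (1 + ‖x‖ + ‖v‖) := by
          nlinarith [norm_nonneg x, norm_nonneg v, ht.1.trans ht.2]
        calc Cℓ * (1 + ‖x - t • v‖ + ‖v‖) ^ p ≤ |Cℓ| * (1 + ‖x - t • v‖ + ‖v‖) ^ p :=
              mul_le_mul_of_nonneg_right (le_abs_self _) (by positivity)
          _ ≤ |Cℓ| * ((1 + T) * (1 + ‖x‖ + ‖v‖)) ^ p :=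
              mul_le_mul_of_nonneg_left (pow_le_pow_left₀ (by positivity) hb p) (abs_nonneg _)
          _ = |Cℓ| * (1 + T) ^ p * (1 + ‖x‖ + ‖v‖) ^ p := by rw [mul_pow]; ring
      have h4 : C₀ * t ≤ |C₀| * T := by
        calc C₀ * t ≤ |C₀| * t := mul_le_mul_of_nonneg_right (le_abs_self _) ht.1
          _ ≤ |C₀| * T := mul_le_mul_of_nonneg_left ht.2 (abs_nonneg _)
      linarith [neg_abs_le (Real.log (f₀' (x - t • v) v))]
    rw [abs_le]
    constructor
    · have : Ls * 1 ≤ Ls * (1 + ‖x‖ + ‖v‖) ^ p := mul_le_mul_of_nonneg_left hw1 hLs0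
      have : |C₀| * T * 1 ≤ |C₀| * T * (1 + ‖x‖ + ‖v‖) ^ p := mul_le_mul_of_nonneg_left hw1 (by positivity)
      nlinarith [hlowlog]
    · have : Ls * 1 ≤ Ls * (1 + ‖x‖ + ‖v‖) ^ p := mul_le_mul_of_nonneg_left hw1 hLs0
      nlinarith [hup, mul_nonneg (mul_nonneg (abs_nonneg Cℓ) (pow_nonneg (by linarith : (0:ℝ) ≤ 1 + T) p))
        (le_trans zero_le_one hw1), mul_nonneg (mul_nonneg (abs_nonneg C₀) hT) (le_trans zero_le_one hw1)]
  · -- the equation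
    intro t ht x v
    have heq := derivWithin_add_fderiv_kinetic hD hψd hψc ht x v
    rw [heq, hψ]
    obtain ⟨C, hC⟩ := hFi.slice_bounds t
    exact (truncatedCollisionOp_eq hBk h (hFi.contDiff t) (hFi.nonneg t) hC δ x v).symm
  · -- the initial datum
    funext x v
    have := hfix 0 (x, v)
    simp only [max_self, zero_smul, sub_zero, intervalIntegral.integral_same, neg_zero, Real.exp_zero, mul_one,
      add_zero] at this
    exact this

end Literature.MathematicalPhysics.KineticTheory
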